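import Summits.BirchSwinnertonDyer.BirchSwinnertonDyer.Theorems.KimAtThreeD7uTamagawaDefectTamDiv
import Summits.BirchSwinnertonDyer.Rank1Residual.GaloisImage.KatoKuriharaDictionaryThree
import Literature.NumberTheory.EllipticCurves.KuriharaNumberDeepInvariants
import HarnessLib

/-!
# The TAMAGAWA-DIVISIBLE bad places, XXII: «TamDiv∞» in KURIHARA-NUMBER currency — the interface
# (cell `bsd-addord`, seat w2-tamdiv gen 7; route W2 `KimAtThreeKolyvagin`, items 19679 / 19562 / 19599 (TD),
# 19560)

HONEST FRAMING: TOOL theorems (no definition, no named fact, no `sorry`); closes nothing by itself;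
nothing is booked; BSD is not proved by any of this.  Parts XV–XXI of this series proved «TamDiv∞» at the
level of the MODULE of Kolyvagin systems for [MR04] Remark A.5's unramified structure `𝓕_u`
(`3^{k+1} ∣ c_ℓ ⇒ KS(E[3^k·3], 𝓕_u, D k) = 0`, part XV; exact threshold `max_ℓ v₃(c_ℓ)`, parts XVII–XXI).
The route's consumers speak KURIHARA NUMBERS: the (TD) binder of crux 19679's corner road
(`KimAtThreeDeepLowerOffStratumCornerKeysSharp.stub_nonAdditive_of_sharpCornerLowerHalves_of_tamagawa_le_deepInfty`,
hypothesis `hTD`) reads `(v₃ ∏ c_ℓ : ℕ∞) ≤ kuriharaPartialDeepInfty W 3 f`.  This file is the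
vocabulary bridge between the two currencies; nothing in it is specific to a reduction type.

## What

* §1 (every `p`) — DEEP-INVARIANT BOOKKEEPING on `Literature.…KuriharaNumberDeepInvariants`:
  `le_kuriharaPartialDeepAt_of_forall_kuriharaDivisibleAt`,
  **`le_kuriharaPartialDeepInfty_of_forall_kuriharaDivisibleAt`** (`δ̃_n ∈ 3^m ℤ₃/I_n` for every CYCLIC
  level `n ∈ 𝒩_m(E,p)` ⇒ `(m : ℕ∞) ≤ ∂^{(∞)}_{deep}(δ̃)`), `kuriharaDivisibleAt_of_forall_exists_eq_zero`
  (vanishing for ONE surjective system of discrete logarithms per depth suffices,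
  `kuriharaNumber_eq_zero_iff_of_surjective`), and the depth-indexed form
  **`le_kuriharaPartialDeepInfty_of_forall_exists_eq_zero`**.
* §2 (`p = 3`, the PORT″ witness shape `GaloisImage.KatoKuriharaWitnessAt W k t D v₃ P κ Λ κ'` of cell
  n1011) — THE KEY: if the Kolyvagin system `κ'` of the (I4) bridge VANISHES (e.g. because it lies in
  `KS(E[3^k·3], 𝓕', D) = ⊥` for some structure `𝓕'` — part XV with `𝓕' = 𝓕_u`), then Kato's derivative
  family `κ` vanishes at every level (unitriangularity, `apply_eq_zero_of_sub_mem_closure_ssubsets`) and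
  the dictionary clause (DICT3) `Λ(loc_{v₃} κ_d) = u_d · 3^t · δ̃_{n(d)}` forces
  **`3^t · δ̃^{(k+1)}_{n(d)} = 0`** at every level `d` of the datum
  (`pow_mul_kuriharaNumber_eq_zero_of_witnessAt_of_forall_eq_zero`), i.e. **`δ̃^{(k+1)}_{n(d)} = 0` at
  `t = 0`** (`kuriharaNumber_eq_zero_of_witnessAt_of_mem_kolyvaginSystems_eq_bot`).
* §3 — the ℕ-currency adapter `exists_surjective_kuriharaNumber_eq_zero_of_prod_eq`: a vanishing at the
  Finset-level `d` with `∏_{q ∈ d} N q = n` is a vanishing at the ℕ-level `n` for a system of discrete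
  logarithms surjective at every prime factor of `n` (the shape §1 consumes).

Parts XXIII ff. compose §1–§3 with part XV and n1011's bridge (B1)
`GaloisImage.FrobShape.exists_level_of_kolyvaginProduct` (every cyclic `n ∈ 𝒩_{k+1}(E,3)` is a level of
the `τ`-datum) into the DEEP bound `max_ℓ v₃(c_ℓ) ≤ ∂^{(∞)}_{deep}(δ̃)` modulo a displayed `𝓕_u`-witness.

What is NOT here: any Euler system, any instance of the witness (the PORT″ dischargers ★PK-6₂ of n1011
produce `κ' ∈ KS(𝓕_can)`; the `𝓕_u`-membership is seat gen 2's ES → KS(𝓕_u)); the product form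
`v₃(∏ c_ℓ)` on rows with two Tamagawa-`3` primes (Kim 2025 Conj. 7.1; not obtainable from KS, part XVII).
References: B. Mazur, K. Rubin, Mem. AMS 799 (2004) Def. 4.5.7, 5.2.11, Thm. 5.2.12 (i), App. A (33),
Remark A.5; C.-H. Kim, AJM 148 (2026) §1.4.3, §1.5.1, Def. 2.13, Thm. 3.13; K. Büyükboduk, JNT 129 (2009)
Thm. 3.1, Cor. 3.3.
-/

noncomputable section

-- the cell's Theorems namespace `Summit.BirchSwinnertonDyer.BirchSwinnertonDyer.…` repeats the summit name by design (D-0017)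
set_option linter.dupNamespace false

open scoped Classical NumberField ContRepresentation
open Function Field NumberField IsDedekindDomain WeierstrassCurve
  Literature.NumberTheory.EllipticCurves Literature.NumberTheory.EllipticCurves.ModularForms
  Literature.NumberTheory.GaloisRepresentations
  Literature.NumberTheory.GaloisRepresentations.DiscreteGaloisModule Literature.NumberTheory.GaloisCohomology
open Summit.BirchSwinnertonDyer.Rank1Residual.GaloisImage

namespace Summit.BirchSwinnertonDyer.BirchSwinnertonDyer.Theorems.KimAtThreeD7uTamagawaKurihara

/-! ### §1 Deep-invariant bookkeeping (every `p`) -/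

section Deep

variable (W : WeierstrassCurve ℚ) [W.IsGloballyMinimal] (p : ℕ) {N : ℕ}
  (f : CuspForm (CongruenceSubgroup.Gamma0 N) 2)

/-- **`m ≤ k` and `δ̃_n ∈ p^m ℤ_p/I_n` at every cyclic `n ∈ 𝒩_k(E,p)` with `ν(n) = i` ⇒
`m ≤ ∂^{(i)}(δ̃^{(k)})`** (Mazur–Rubin's level-`k` invariant read on Kurihara numbers: each term
`min(k, ord_p δ̃_n)` of the infimum is `≥ m`). [cite: MazurRubin2004, Def. 4.5.7 and Thm. 5.2.12 (i)]
[cite: Kim2022StructureSelmer, Def. 2.13 (PDF p. 14)] -/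
theorem le_kuriharaPartialDeepAt_of_forall_kuriharaDivisibleAt {m k : ℕ} (hmk : m ≤ k) (i : ℕ)
    (h : ∀ n : ℕ, IsCyclicKolyvaginLevel W p n → Kato.IsKolyvaginProduct W p k n →
      n.primeFactors.card = i → KuriharaDivisibleAt W p f n m) :
    (m : ℕ∞) ≤ kuriharaPartialDeepAt W p f k i := by
  rw [kuriharaPartialDeepAt_def]
  refine le_iInf fun n => le_iInf fun hn => le_iInf fun hk => le_iInf fun hi => ?_
  exact le_min (by exact_mod_cast hmk) (le_kuriharaDivIndex_of_divisibleAt W p f (h n hn hk hi))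

/-- **«TamDiv-deep» bookkeeping: `δ̃_n ∈ p^m ℤ_p/I_n` at every CYCLIC level `n ∈ 𝒩_m(E,p)` ⇒
`(m : ℕ∞) ≤ ∂^{(∞)}_{deep}(δ̃)`.**  For every `i` the level-`m` invariant `∂^{(i)}(δ̃^{(m)})` is `≥ m`
(`le_kuriharaPartialDeepAt_of_forall_kuriharaDivisibleAt`), hence so is its supremum over the depth
`∂^{(i)}_{deep}` and the infimum over `i`.  (Levels of depth `> m` are levels of depth `m`,
`Kato.IsKolyvaginProduct.mono`, so nothing is required of them separately.)
[cite: MazurRubin2004, Def. 5.2.11 and Thm. 5.2.12 (i)] [cite: Kim2022StructureSelmer, §1.5.1 (PDF p. 7), Def. 2.13] -/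
theorem le_kuriharaPartialDeepInfty_of_forall_kuriharaDivisibleAt (m : ℕ)
    (h : ∀ n : ℕ, IsCyclicKolyvaginLevel W p n → Kato.IsKolyvaginProduct W p m n →
      KuriharaDivisibleAt W p f n m) :
    (m : ℕ∞) ≤ kuriharaPartialDeepInfty W p f :=
  le_iInf fun i =>
    (le_kuriharaPartialDeepAt_of_forall_kuriharaDivisibleAt W p f le_rfl i
      fun n hn hk _ => h n hn hk).trans (kuriharaPartialDeepAt_le_kuriharaPartialDeep W p f m i)

/-- **Vanishing for ONE surjective system of discrete logarithms per depth gives `δ̃_n ∈ p^m ℤ_p/I_n`.**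
If for every `1 ≤ k ≤ m` with `n ∈ 𝒩_k(E,p)` SOME `ψ = (ψ_ℓ : (ℤ/ℓ)ˣ ↠ ℤ/p^k)_{ℓ ∣ n}` has
`δ̃^{(k)}_n(ψ) = 0`, then `δ̃^{(k)}_n(ψ') = 0` for EVERY surjective `ψ'` (the choice changes `δ̃_n` by a
unit, `kuriharaNumber_eq_zero_iff_of_surjective`), i.e. `KuriharaDivisibleAt W p f n m`; depth `0` is
vacuous (`ℤ/p^0 = 0`). [cite: Kim2022StructureSelmer, §1.4.3 and §1.5.1 (PDF p. 7)]
[cite: Kurihara2014, §1.1 (3) (PDF p. 2)] -/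
theorem kuriharaDivisibleAt_of_forall_exists_eq_zero (n m : ℕ)
    (h : ∀ k : ℕ, 1 ≤ k → k ≤ m → ∀ hk : Kato.IsKolyvaginProduct W p k n,
      haveI : NeZero n := ⟨hk.ne_zero⟩
      ∃ ψ : (ℓ : ℕ) → (ZMod ℓ)ˣ →* Multiplicative (ZMod (p ^ k)),
        (∀ ℓ ∈ n.primeFactors, Function.Surjective (ψ ℓ)) ∧ kuriharaNumber f (p ^ k) n ψ = 0) :
    KuriharaDivisibleAt W p f n m := by
  intro k hkm hkn ψ hψ
  rcases Nat.eq_zero_or_pos k with rfl | hk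
  · haveI : Subsingleton (ZMod (p ^ 0)) := ZMod.subsingleton_iff.mpr (pow_zero p)
    exact Subsingleton.elim _ _
  · haveI : NeZero n := ⟨hkn.ne_zero⟩
    obtain ⟨ψ₀, hψ₀, h0⟩ := h k hk hkm hkn
    exact (kuriharaNumber_eq_zero_iff_of_surjective f (p ^ k) n hψ₀ hψ).mpr h0

/-- **Depth-indexed form of the deep bound**: if at every depth `k < m` every CYCLIC level
`n ∈ 𝒩_{k+1}(E,p)` carries a vanishing `δ̃^{(k+1)}_n(ψ) = 0` for SOME surjective `ψ`, then
`(m : ℕ∞) ≤ ∂^{(∞)}_{deep}(δ̃)`.  (This is the shape in which a depth-`k` Kolyvagin-system argument on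
`E[p^k·p]` delivers its conclusion; `𝒩_m ⊆ 𝒩_{k+1}` for `k < m`.)
[cite: MazurRubin2004, Def. 5.2.11 and Thm. 5.2.12 (i)] [cite: Kim2022StructureSelmer, §1.5.1 (PDF p. 7), Def. 2.13] -/
theorem le_kuriharaPartialDeepInfty_of_forall_exists_eq_zero (m : ℕ)
    (h : ∀ k : ℕ, k < m → ∀ n : ℕ, IsCyclicKolyvaginLevel W p n →
      ∀ hk : Kato.IsKolyvaginProduct W p (k + 1) n,
      haveI : NeZero n := ⟨hk.ne_zero⟩
      ∃ ψ : (ℓ : ℕ) → (ZMod ℓ)ˣ →* Multiplicative (ZMod (p ^ (k + 1))),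
        (∀ ℓ ∈ n.primeFactors, Function.Surjective (ψ ℓ)) ∧
          kuriharaNumber f (p ^ (k + 1)) n ψ = 0) :
    (m : ℕ∞) ≤ kuriharaPartialDeepInfty W p f := by
  refine le_kuriharaPartialDeepInfty_of_forall_kuriharaDivisibleAt W p f m fun n hn _ => ?_
  refine kuriharaDivisibleAt_of_forall_exists_eq_zero W p f n m fun k hk1 hkm hkn => ?_
  obtain ⟨k', rfl⟩ : ∃ k', k = k' + 1 := ⟨k - 1, (Nat.sub_add_cancel hk1).symm⟩
  exact h k' (by omega) n hn hkn

end Deep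

/-! ### §2 The PORT″ witness with a VANISHING Kolyvagin system (`p = 3`) -/

section Witness

/-- **Unitriangular vanishing** (pure algebra): if `κ'_d − κ_d` lies in the span of the `κ_c`, `c ⊊ d`,
for every `d` in a family `S` of finite sets closed under passing to proper subsets, and `κ' = 0` on `S`,
then `κ = 0` on `S` (strong induction on `d`).  [MR04] App. A (33): the Kolyvagin system attached to an
Euler system is unitriangular in the derivative classes. [cite: MazurRubin2004, App. A, eq. (33) (p. 80)] -/
theorem apply_eq_zero_of_sub_mem_closure_ssubsets {X A : Type*} [AddCommGroup A] (κ κ' : Finset X → A)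
    (S : Set (Finset X)) (hS : ∀ d ∈ S, ∀ c, c ⊂ d → c ∈ S)
    (hbr : ∀ d ∈ S, κ' d - κ d ∈ AddSubgroup.closure {x | ∃ c, c ⊂ d ∧ x = κ c})
    (hκ' : ∀ d ∈ S, κ' d = 0) : ∀ d ∈ S, κ d = 0 := by
  intro d
  induction d using Finset.strongInduction with
  | H d ih =>
    intro hd
    have hcl : AddSubgroup.closure {x | ∃ c, c ⊂ d ∧ x = κ c} = ⊥ := by
      rw [AddSubgroup.closure_eq_bot_iff]
      rintro x ⟨c, hcd, rfl⟩
      exact ih c hcd (hS d hd c hcd)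
    have h := hbr d hd
    rw [hcl, AddSubgroup.mem_bot, hκ' d hd, zero_sub, neg_eq_zero] at h
    exact h

variable (W : WeierstrassCurve ℚ) [W.IsElliptic] [W.IsGloballyMinimal] {k t : ℕ}
  {D : KolyvaginDatum (W.torsionGaloisModule (((3 : ℕ) : ℤ) ^ k * ((3 : ℕ) : ℤ)))}
  {v₃ : HeightOneSpectrum (𝓞 ℚ)} {N : ℕ} [NeZero N] {P : ModularParametrizationData W N}
  {κ : Finset (HeightOneSpectrum (𝓞 ℚ)) →
    galoisCohomology (W.torsionGaloisModule (((3 : ℕ) : ℤ) ^ k * ((3 : ℕ) : ℤ))) 1}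
  {Λ : galoisCohomology ((W.torsionGaloisModule (((3 : ℕ) : ℤ) ^ k * ((3 : ℕ) : ℤ))).toLocal
    (Sum.inr v₃)) 1 →+ ZMod (3 ^ (k + 1))}
  {κ' : Finset (HeightOneSpectrum (𝓞 ℚ)) →
    galoisCohomology (W.torsionGaloisModule (((3 : ℕ) : ℤ) ^ k * ((3 : ℕ) : ℤ))) 1}

/-- **If the (I4) Kolyvagin system `κ'` of a PORT″ witness vanishes on the levels, so does Kato's
derivative family `κ`** (clause (I4) of `KatoKuriharaWitnessAt`: `κ'_d − κ_d ∈ ℤ-span{κ_c : c ⊊ d}`;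
levels are the finite subsets of `𝒫(D)`, closed under subsets). [cite: MazurRubin2004, Thm. 3.2.4 and App. A (33)]
[cite: Kim2022StructureSelmer, §2.3.2 (arXiv p. 12, last sentence)] -/
theorem apply_eq_zero_of_witnessAt_of_forall_eq_zero (hW : KatoKuriharaWitnessAt W k t D v₃ P κ Λ κ')
    (hκ' : ∀ d, D.IsLevel d → κ' d = 0) {d : Finset (HeightOneSpectrum (𝓞 ℚ))} (hd : D.IsLevel d) :
    κ d = 0 :=
  apply_eq_zero_of_sub_mem_closure_ssubsets κ κ' {d | D.IsLevel d}
    (fun _ hd' _ hc => Set.Subset.trans (Finset.coe_subset.mpr hc.subset) hd')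
    (fun d' hd' => hW.2.1.2 d' hd') hκ' d hd

/-- **(DICT3) with a vanishing Kolyvagin system: `3^t · δ̃^{(k+1)}_{n(d)} = 0` at every level.**
From `KatoKuriharaWitnessAt W k t D v₃ P κ Λ κ'` and `κ' = 0` on the levels: `κ_d = 0`
(`apply_eq_zero_of_witnessAt_of_forall_eq_zero`), so `u_d · 3^t · δ̃_{n(d)} = Λ(loc_{v₃} κ_d) = 0` in
`ℤ/3^{k+1}` with `u_d` a unit — for the witness's own surjective discrete logarithms `ψ`.
[cite: Kim2022StructureSelmer, Thm. 3.13 (arXiv p. 17)] [cite: MazurRubin2004, App. A (33) and Remark A.5] -/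
theorem pow_mul_kuriharaNumber_eq_zero_of_witnessAt_of_forall_eq_zero
    (hW : KatoKuriharaWitnessAt W k t D v₃ P κ Λ κ') (hκ' : ∀ d, D.IsLevel d → κ' d = 0)
    {d : Finset (HeightOneSpectrum (𝓞 ℚ))} (hd : D.IsLevel d) :
    ∃ ψ : (ℓ : ℕ) → (ZMod ℓ)ˣ →* Multiplicative (ZMod (3 ^ (k + 1))),
      (∀ q ∈ d, Function.Surjective (ψ (Ideal.absNorm q.asIdeal))) ∧
      haveI : NeZero (∏ q ∈ d, Ideal.absNorm q.asIdeal) :=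
        ⟨Finset.prod_ne_zero_iff.2 fun q _ h => q.ne_bot (Ideal.absNorm_eq_zero_iff.1 h)⟩
      (3 : ZMod (3 ^ (k + 1))) ^ t *
        kuriharaNumber P.f (3 ^ (k + 1)) (∏ q ∈ d, Ideal.absNorm q.asIdeal) ψ = 0 := by
  obtain ⟨u, ψ, hψ, heq⟩ := hW.2.2.2.2 d hd
  refine ⟨ψ, hψ, ?_⟩
  have hκ0 : κ d = 0 := apply_eq_zero_of_witnessAt_of_forall_eq_zero W hW hκ' hd
  rw [hκ0, map_zero, map_zero] at heq
  have h := heq.symm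
  rwa [mul_assoc, Units.mul_right_eq_zero] at h

/-- **«TamDiv» in Kurihara currency at ONE depth, `t = 0`: a PORT″ witness whose Kolyvagin system lies
in a VANISHING module `KS(E[3^k·3], 𝓕', D) = ⊥` has `δ̃^{(k+1)}_{n(d)} = 0` at EVERY level `d`** — for
the witness's own surjective `ψ`, hence for every surjective choice
(`kuriharaNumber_eq_zero_iff_of_surjective`).  With `𝓕' = 𝓕_u = blochKatoSelmerStructure 3
(tateTorsionDatum W 3 k) ⊤` ([MR04] Remark A.5's structure, into which a Kato-type Euler system maps —
seat gen 2) and `3^{k+1} ∣ c_ℓ` the module vanishes by part XV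
(`KimAtThreeD7uTamagawaDefectDevissage.kolyvaginSystems_blochKatoRelaxed_eq_bot_of_pow_succ_dvd`).
[cite: Buyukboduk2009TamagawaDefect, Thm. 3.1 and Cor. 3.3] [cite: Kim2022StructureSelmer, Thm. 3.13 (arXiv p. 17)]
[cite: MazurRubin2004, App. A Remark A.5 (p. 81)] -/
theorem kuriharaNumber_eq_zero_of_witnessAt_of_mem_kolyvaginSystems_eq_bot
    (hW : KatoKuriharaWitnessAt W k 0 D v₃ P κ Λ κ')
    {𝓕' : SelmerStructure (W.torsionGaloisModule (((3 : ℕ) : ℤ) ^ k * ((3 : ℕ) : ℤ)))}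
    (hκ' : κ' ∈ D.kolyvaginSystems 𝓕') (hbot : D.kolyvaginSystems 𝓕' = ⊥)
    {d : Finset (HeightOneSpectrum (𝓞 ℚ))} (hd : D.IsLevel d) :
    ∃ ψ : (ℓ : ℕ) → (ZMod ℓ)ˣ →* Multiplicative (ZMod (3 ^ (k + 1))),
      (∀ q ∈ d, Function.Surjective (ψ (Ideal.absNorm q.asIdeal))) ∧
      haveI : NeZero (∏ q ∈ d, Ideal.absNorm q.asIdeal) :=
        ⟨Finset.prod_ne_zero_iff.2 fun q _ h => q.ne_bot (Ideal.absNorm_eq_zero_iff.1 h)⟩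
      kuriharaNumber P.f (3 ^ (k + 1)) (∏ q ∈ d, Ideal.absNorm q.asIdeal) ψ = 0 := by
  have h0 : κ' = 0 := by
    rw [hbot] at hκ'
    exact (AddSubgroup.mem_bot).mp hκ'
  obtain ⟨ψ, hψ, heq⟩ := pow_mul_kuriharaNumber_eq_zero_of_witnessAt_of_forall_eq_zero W hW
    (fun d _ => by rw [h0]; rfl) hd
  exact ⟨ψ, hψ, by simpa only [pow_zero, one_mul] using heq⟩

end Witness

/-! ### §3 The ℕ-currency adapter -/

section Level

/-- **From a Finset-level to the ℕ-level.**  If `∏_{q ∈ d} N q = n` with every `N q` (`q ∈ d`) a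
prime factor of `n` (the shape of n1011's bridge (B1) `FrobShape.exists_level_of_kolyvaginProduct`), a
system `ψ` surjective at the `N q`, `q ∈ d`, with `δ̃^{(M)}(∏ N q, ψ) = 0` is a system surjective at every
prime factor of `n` with `δ̃^{(M)}_n(ψ) = 0` (every prime factor `ℓ` of `n` divides some `N q`, which is
prime, so `ℓ = N q`). [cite: Kim2022StructureSelmer, §1.2.2 and §1.4.3 (PDF p. 7)] -/
theorem exists_surjective_kuriharaNumber_eq_zero_of_prod_eq {N : ℕ} (f : CuspForm (CongruenceSubgroup.Gamma0 N) 2)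
    (M : ℕ) {d : Finset (HeightOneSpectrum (𝓞 ℚ))} {n : ℕ} [NeZero n]
    (hprod : ∏ q ∈ d, Ideal.absNorm q.asIdeal = n)
    (hmem : ∀ q ∈ d, Ideal.absNorm q.asIdeal ∈ n.primeFactors)
    {ψ : (ℓ : ℕ) → (ZMod ℓ)ˣ →* Multiplicative (ZMod M)}
    (hψ : ∀ q ∈ d, Function.Surjective (ψ (Ideal.absNorm q.asIdeal)))
    (h0 : haveI : NeZero (∏ q ∈ d, Ideal.absNorm q.asIdeal) :=
        ⟨Finset.prod_ne_zero_iff.2 fun q _ h => q.ne_bot (Ideal.absNorm_eq_zero_iff.1 h)⟩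
      kuriharaNumber f M (∏ q ∈ d, Ideal.absNorm q.asIdeal) ψ = 0) :
    (∀ ℓ ∈ n.primeFactors, Function.Surjective (ψ ℓ)) ∧ kuriharaNumber f M n ψ = 0 := by
  refine ⟨fun ℓ hℓ => ?_, ?_⟩
  · obtain ⟨hℓp, hℓn, -⟩ := Nat.mem_primeFactors.mp hℓ
    rw [← hprod] at hℓn
    obtain ⟨q, hq, hℓq⟩ := (Prime.dvd_finsetProd_iff hℓp.prime _).mp hℓn
    have hq' := Nat.prime_of_mem_primeFactors (hmem q hq)
    obtain rfl : ℓ = Ideal.absNorm q.asIdeal :=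
      (Nat.prime_dvd_prime_iff_eq hℓp hq').mp hℓq
    exact hψ q hq
  · subst hprod
    convert h0

end Level

/-! ### §4 Composition with part XV: `3^{k+1} ∣ c_ℓ` and a `𝓕_u`-witness ⇒ `δ̃^{(k+1)}_{n(d)} = 0` -/

section TamDiv

open Summit.BirchSwinnertonDyer.BirchSwinnertonDyer.Theorems.KimAtThreeD7uTamagawaDefectDevissage

variable (W : WeierstrassCurve ℚ) [W.IsElliptic] [W.IsGloballyMinimal]

/-- **«TamDiv∞» in Kurihara currency at depth `k`, `t = 0`** — part XV composed with §2: on the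
binders of part XV VERBATIM (Poitou–Tate family `inv` at `3`, Tate's `hEP`, `T ⊇ {3} ∪ bad`, a finite
`ℓ ∤ 3` with **`3^{k+1} ∣ c_ℓ`**, no `Γ_ℚ`-fixed points, the (H.2)-cokernels of `τ`, canonical admissible
data `D j` on ONE prime set `P ⊆` the `τ`-class at level `3^{k+1}` with ONE `η`, the level-one prime
choice `hprime`) and a PORT″ witness `KatoKuriharaWitnessAt W k 0 (D k) v₃ P₀ κ Λ κ'` whose Kolyvagin
system `κ'` lies in `KS(E[3^k·3], 𝓕_u, D k)` for [MR04] Remark A.5's `𝓕_u` (the structure a Kato-type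
Euler system maps to, seat gen 2): **every level `d` of `D k` has `δ̃^{(k+1)}_{n(d)} = 0`** (for a
surjective system of discrete logarithms; hence for all).  The module `KS(E[3^k·3], 𝓕_u, D k)` is `⊥`
by part XV, so §2 applies.  Büyükboduk 2009 Thm. 3.1 / Cor. 3.3 read on Kurihara numbers through Kim's
dictionary, at the exponent `k + 1 ≤ v₃(c_ℓ)`, every reduction type at `ℓ`.
[cite: Buyukboduk2009TamagawaDefect, Thm. 3.1 and Cor. 3.3] [cite: MazurRubin2004, Prop. 6.2.6 and App. A Remark A.5]
[cite: Kim2022StructureSelmer, Thm. 3.13 (arXiv p. 17)] -/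
theorem kuriharaNumber_eq_zero_of_witnessAt_blochKatoRelaxed_of_pow_succ_dvd
    [Finite (geomTorsion W ((3 : ℕ) : ℤ))] [Finite (geomTorsion W (((3 : ℕ) : ℤ) ^ 0 * ((3 : ℕ) : ℤ)))]
    {inv : LocalInvariants ℚ 3}
    (hperf : inv.IsPerfect) (hsum : inv.SumLocalTermEqZero) (hcompl : inv.SelmerComplement)
    (hEP : ∀ v : HeightOneSpectrum (𝓞 ℚ), localEulerPoincareCharacteristic (v.adicCompletion ℚ))
    (T : Finset (HeightOneSpectrum (𝓞 ℚ)))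
    (h3T : ∀ v : HeightOneSpectrum (𝓞 ℚ), ((3 : ℕ) : 𝓞 ℚ) ∈ v.asIdeal → v ∈ T)
    (hbadT : ∀ v : HeightOneSpectrum (𝓞 ℚ), ¬ W.HasGoodReductionAt v → v ∈ T)
    {ℓ : HeightOneSpectrum (𝓞 ℚ)} (h3ℓ : ((3 : ℕ) : 𝓞 ℚ) ∉ ℓ.asIdeal) (k : ℕ)
    (hk : 3 ^ (k + 1) ∣ (W.baseChange (ℓ.adicCompletion ℚ)).localTamagawaNumber (ℓ.adicCompletionIntegers ℚ))
    (h0 : ∀ (j : ℕ) (Q : geomTorsion W (((3 : ℕ) : ℤ) ^ j * ((3 : ℕ) : ℤ))),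
      (∀ σ : absoluteGaloisGroup ℚ,
        W.torsionGaloisModule (((3 : ℕ) : ℤ) ^ j * ((3 : ℕ) : ℤ)) σ Q = Q) → Q = 0)
    {Sset : Set (HeightOneSpectrum (𝓞 ℚ))} {τ : absoluteGaloisGroup ℚ}
    (hτ : ∀ j : ℕ, Nonempty (cokerSubOne (W.torsionGaloisModule (((3 : ℕ) : ℤ) ^ j * ((3 : ℕ) : ℤ))) τ ≃+
      ZMod (3 ^ (j + 1))))
    (hτ₁ : Nonempty (cokerSubOne (W.torsionGaloisModule ((3 : ℕ) : ℤ)) τ ≃+ ZMod 3))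
    (hτμ : τ ∈ rootsOfUnityFixer ℚ (3 ^ (k + 1)))
    (D : (j : ℕ) → KolyvaginDatum (W.torsionGaloisModule (((3 : ℕ) : ℤ) ^ j * ((3 : ℕ) : ℤ))))
    {P : Set (HeightOneSpectrum (𝓞 ℚ))} (hP : ∀ j, (D j).primes = P) (hPT : ∀ q ∈ P, q ∉ T)
    (hPc : P ⊆ frobeniusClassPrimes
      (W.torsionGaloisModule (((3 : ℕ) : ℤ) ^ k * ((3 : ℕ) : ℤ))) Sset τ (3 ^ (k + 1)))
    (hT : ∀ j, (D j).transverse = cyclotomicTransverse _)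
    {η : (q : HeightOneSpectrum (𝓞 ℚ)) → (ZMod (Ideal.absNorm q.asIdeal))ˣ}
    (hD : ∀ j, (D j).HasCanonicalComparison (3 ^ (j + 1)) η) (hadm : ∀ j, (D j).IsAdmissible)
    (hprime : ∀ c : galoisCohomology (W.torsionGaloisModule (((3 : ℕ) : ℤ) ^ 0 * ((3 : ℕ) : ℤ))) 1, c ≠ 0 →
      ∀ c' : galoisCohomology (DiscreteGaloisModule.tateDual
        (W.torsionGaloisModule (((3 : ℕ) : ℤ) ^ 0 * ((3 : ℕ) : ℤ))) 3) 1, c' ≠ 0 →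
      {q ∈ (D 0).primes |
        galoisCohomology.localization (W.torsionGaloisModule (((3 : ℕ) : ℤ) ^ 0 * ((3 : ℕ) : ℤ)))
          (Sum.inr q) 1 c ≠ 0 ∧
        galoisCohomology.localization (DiscreteGaloisModule.tateDual
          (W.torsionGaloisModule (((3 : ℕ) : ℤ) ^ 0 * ((3 : ℕ) : ℤ))) 3) (Sum.inr q) 1 c' ≠ 0}.Infinite)
    -- the PORT″ witness at depth `k` on the datum `D k`, with its Kolyvagin system in `𝓕_u`
    {v₃ : HeightOneSpectrum (𝓞 ℚ)} {N : ℕ} [NeZero N] {P₀ : ModularParametrizationData W N}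
    {κ : Finset (HeightOneSpectrum (𝓞 ℚ)) →
      galoisCohomology (W.torsionGaloisModule (((3 : ℕ) : ℤ) ^ k * ((3 : ℕ) : ℤ))) 1}
    {Λ : galoisCohomology ((W.torsionGaloisModule (((3 : ℕ) : ℤ) ^ k * ((3 : ℕ) : ℤ))).toLocal
      (Sum.inr v₃)) 1 →+ ZMod (3 ^ (k + 1))}
    {κ' : Finset (HeightOneSpectrum (𝓞 ℚ)) →
      galoisCohomology (W.torsionGaloisModule (((3 : ℕ) : ℤ) ^ k * ((3 : ℕ) : ℤ))) 1}
    (hW : KatoKuriharaWitnessAt W k 0 (D k) v₃ P₀ κ Λ κ')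
    (hκ'u : κ' ∈ (D k).kolyvaginSystems (blochKatoSelmerStructure 3 (tateTorsionDatum W 3 k) (fun _ _ => ⊤)))
    {d : Finset (HeightOneSpectrum (𝓞 ℚ))} (hd : (D k).IsLevel d) :
    ∃ ψ : (ℓ : ℕ) → (ZMod ℓ)ˣ →* Multiplicative (ZMod (3 ^ (k + 1))),
      (∀ q ∈ d, Function.Surjective (ψ (Ideal.absNorm q.asIdeal))) ∧
      haveI : NeZero (∏ q ∈ d, Ideal.absNorm q.asIdeal) :=
        ⟨Finset.prod_ne_zero_iff.2 fun q _ h => q.ne_bot (Ideal.absNorm_eq_zero_iff.1 h)⟩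
      kuriharaNumber P₀.f (3 ^ (k + 1)) (∏ q ∈ d, Ideal.absNorm q.asIdeal) ψ = 0 :=
  kuriharaNumber_eq_zero_of_witnessAt_of_mem_kolyvaginSystems_eq_bot W hW hκ'u
    (kolyvaginSystems_blochKatoRelaxed_eq_bot_of_pow_succ_dvd W hperf hsum hcompl hEP T h3T hbadT h3ℓ k hk
      h0 hτ hτ₁ hτμ D hP hPT hPc hT hD hadm hprime) hd

end TamDiv

end Summit.BirchSwinnertonDyer.BirchSwinnertonDyer.Theorems.KimAtThreeD7uTamagawaKurihara

end
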